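import Mathlib
import Summits.NavierStokesRegularity.NavierStokesRegularity.Theorems.L3TimeExponentPincerMorreyInterpolationBelow
import Summits.NavierStokesRegularity.NavierStokesRegularity.Theorems.L3TimeExponentPincerFullMorreyMostTimes
import HarnessLib.Audit
import HarnessLib

/-!
# THEOREM J‴: the SUB-PARABOLIC half of the Morrey hypothesis already gives the jaw for every `q < 6`
# (route `L3TimeExponentPincer`, parent crux `L3CascadeJaw` stmt-NavierStokesRegularity-19499, child crux
# `EffSatBlowup` stmt-…-19139 line `pace`; support file 10 of seat p4)

Support file (cell ns-regularity-ideate, seat p4, gen 5).  0 `sorry`; one definition (the class predicate).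

THEOREM J′ (`…JawFullMorreyHolds`, nsreg-p2 ROUND-9 / nsreg-p4 g4) proves `u ∈ L^q_t L³_x` up to `T` for all
`q ≤ 6` on the FULL-Morrey class: `∫_{B(x₀,r)}|u(t)|² ≤ M r` for all late `t`, all centres and ALL radii
`r < r₁`.  That hypothesis is the conjunction of two halves (`fullMorreyTypeINear_of_morreyTypeI_of_subparabolic`,
`subparabolicMorreyNear_of_full`): the TOP half `MorreyTypeINear` of the pace dichotomy (radii `r > √(T-t)`,
Barker–Prange (1.7) — the class on which stub 2 of line `pace` is typed) and the BOTTOM half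

  `SubparabolicMorreyNear u T`:  `∫_{B(x₀,r)}|u(t)|² ≤ M r` for all late `t`, all `x₀`, all `0 < r ≤ √(T-t)`

(this file's one definition).  Reading the layer-cake proof of the slice inequality (support file 9,
`L3TimeExponentPincerMorreyInterpolationBelow`): the Morrey bound is only ever used at radii `≤ √(T-t)/2`, the
larger radii being replaced by the energy Chebyshev bound at the cost of an additive `(T-t)^{-1}`:

* `l3cube_sq_le_of_subparabolicMorrey` — on the sub-parabolic class,
  `‖u(t)‖₃⁶ = (∫|u(t)|³)² ≤ C₁ · ∫|∇u(t)|² + C₂/(T-t)` for all late `t` (`C₁, C₂ < ∞` explicit in `M, E(u₀)`);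
* **THEOREM J‴** `jaw_lt_six_of_subparabolicMorrey` — hence `∫_{T₂}^{T} ‖u(t)‖₃^q dt < ∞` for EVERY `0 ≤ q < 6`
  (`(C₁δ + C₂/s)^{q/6} ≤ C₁^{q/6}(δ+1) + C₂^{q/6} s^{-q/6}`, both integrable), and
  `l3CascadeJaw_clause_of_subparabolicMorrey` — the clause of the parent crux (every `q ∈ (4,5)`) for every frame
  solution in the sub-parabolic class.  **The top half of J′'s hypothesis buys only the endpoint `q = 6`.**
* hierarchy: `subparabolicMorreyNear_of_typeI` — time-Type-I ⇒ sub-parabolic Morrey, ELEMENTARY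
  (`|u| ≤ C/√s` ⇒ `∫_{B_r}|u|² ≤ V₁C² r³/s ≤ V₁C² r` for `r² ≤ s`; no certificate ladder; with J‴ this re-derives
  the tree's `…JawTypeIElementary.jaw_on_typeI_elementary`), `subparabolicMorreyNear_of_full`,
  `fullMorreyTypeINear_of_morreyTypeI_of_subparabolic` (Full = MTI ∧ Sub).
* most times: `lintegral_fast_inv_sub_lt_top_of_subparabolicMorrey`, `effSat_mostTimes_of_subparabolicMorrey` —
  on sub-parabolic-Morrey blow-ups the `L³`-fast set `{‖u(t)‖₃³ > A/√(T-t)}` is log-null and of density `0` at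
  `T` for every `A > A₀ = √C₂` (fast ⇒ `(A²-C₂)/(T-t) < C₁ δ(t)`, `∫δ < ∞`), and the crux clause `K₃(1)` holds at
  every other late time (support file 7's `fatClauseAt_offFast_of_blowup`).

Reading for the line: the parent jaw and most-times `K₃(1)` never use the top radii; what the route's Morrey
programme really assumes is the absence of SUB-parabolic energy concentration (`E_r(t)/r` bounded for
`r ≤ √(T-t)`), a condition invisible to `MorreyTypeINear`.  WHAT THIS IS NOT: not a claim about Navier–Stokes
regularity; `SubparabolicMorreyNear` for all blow-ups is NOT asserted (it contains time-Type-I and is open beyond);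
no item or stub is closed.
-/

noncomputable section

namespace Summit.NavierStokesRegularity.NavierStokesRegularity.Theorems.L3TimeExponentPincerSubparabolicMorreyJaw

open MeasureTheory Set Function Filter Metric Topology
open scoped ENNReal NNReal
open Literature.Analysis.FluidPDE
open Summit.NavierStokesRegularity.NavierStokesRegularity.Theorems.L3TimeExponentPincerMorreyGrowth (V₁ V₁_nonneg volume_ball_eq)
open Summit.NavierStokesRegularity.NavierStokesRegularity.Theorems.L3TimeExponentPincerJawFullMorrey
  (FullMorreyTypeINear dissipRate dissip_lt_top eLpNorm_three_rpow_eq morreyTypeINear_of_full)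
open Summit.NavierStokesRegularity.NavierStokesRegularity.Theorems.L3TimeExponentPincerJawMorreyRate
  (lintegral_Ioo_rpow_neg_lt_top)
open Summit.NavierStokesRegularity.NavierStokesRegularity.Theorems.L3TimeExponentPincerPaceDichotomy
  (FatClauseAt MorreyTypeINear)
open Summit.NavierStokesRegularity.NavierStokesRegularity.Theorems.L3TimeExponentPincerMorreyInterpolationBelow
  (lintegral_cube_sq_le_of_morreyBelow)
open Summit.NavierStokesRegularity.NavierStokesRegularity.Theorems.L3TimeExponentPincerFullMorreyMostTimes
  (eLpNorm_three_rpow_six_eq density_zero_of_lintegral_indicator_inv_sub_lt_top nullMeasurableSet_fast_of_frame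
    fatClauseAt_offFast_of_blowup ofReal_sq_div_lt_rpow_six)

/-! ## §1  The sub-parabolic Morrey class and its place in the hierarchy -/

/-- **Sub-parabolic Morrey bound near `T`** (the BOTTOM half of `FullMorreyTypeINear`): `∫_{B(x₀,r)} |u(t)|² ≤ M r`
for all late times `t`, all centres `x₀` and all SUB-PARABOLIC radii `0 < r ≤ √(T-t)` — no energy concentration
beyond the scale-invariant rate at scales below the parabolic one.  (The top half, radii `> √(T-t)`, is
`L3TimeExponentPincerPaceDichotomy.MorreyTypeINear`.) -/
def SubparabolicMorreyNear (u : ℝ → (EuclideanSpace ℝ (Fin 3)) → (EuclideanSpace ℝ (Fin 3))) (T : ℝ) : Prop :=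
  ∃ M : ℝ, 0 < M ∧ ∃ T₁ < T, ∀ t ∈ Ioo T₁ T, ∀ x₀ : EuclideanSpace ℝ (Fin 3), ∀ r : ℝ, 0 < r → r ^ 2 ≤ T - t →
    ∫⁻ x in ball x₀ r, ‖u t x‖ₑ ^ 2 ≤ ENNReal.ofReal (M * r)

/-- Full Morrey ⇒ sub-parabolic Morrey (shrink the window until `√(T-t) < r₁`). -/
theorem subparabolicMorreyNear_of_full {u : ℝ → (EuclideanSpace ℝ (Fin 3)) → (EuclideanSpace ℝ (Fin 3))} {T : ℝ}
    (h : FullMorreyTypeINear u T) : SubparabolicMorreyNear u T := by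
  obtain ⟨M, hM, r₁, hr₁, T₁, hT₁, hMor⟩ := h
  refine ⟨M, hM, max T₁ (T - r₁ ^ 2), max_lt hT₁ (by nlinarith), fun t ht x₀ r hr hrs => ?_⟩
  have ht1 : T₁ < t := lt_of_le_of_lt (le_max_left _ _) ht.1
  have ht2 : T - r₁ ^ 2 < t := lt_of_le_of_lt (le_max_right _ _) ht.1
  have hrr : r < r₁ := by
    by_contra hle
    rw [not_lt] at hle
    nlinarith [pow_le_pow_left₀ hr₁.le hle 2]
  exact hMor t ⟨ht1, ht.2⟩ x₀ r hr hrr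

/-- **Full = top ∧ bottom**: the pace dichotomy's `MorreyTypeINear` (radii `> √(T-t)`) together with the
sub-parabolic bound (radii `≤ √(T-t)`) gives `FullMorreyTypeINear`. -/
theorem fullMorreyTypeINear_of_morreyTypeI_of_subparabolic
    {u : ℝ → (EuclideanSpace ℝ (Fin 3)) → (EuclideanSpace ℝ (Fin 3))} {T : ℝ}
    (hM : MorreyTypeINear u T) (hS : SubparabolicMorreyNear u T) : FullMorreyTypeINear u T := by
  obtain ⟨M, hMpos, r₁, hr₁, hTop⟩ := hM
  obtain ⟨M', hM'pos, T₁, hT₁, hBot⟩ := hS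
  refine ⟨max M M', lt_max_of_lt_left hMpos, r₁, hr₁, T₁, hT₁, fun t ht x₀ r hr hrr => ?_⟩
  rcases le_or_gt (r ^ 2) (T - t) with hcase | hcase
  · exact (hBot t ht x₀ r hr hcase).trans (ENNReal.ofReal_le_ofReal
      (mul_le_mul_of_nonneg_right (le_max_right _ _) hr.le))
  · have h1 : T - r ^ 2 < t := by linarith
    exact (hTop x₀ r hr hrr t h1 ht.2).trans (ENNReal.ofReal_le_ofReal
      (mul_le_mul_of_nonneg_right (le_max_left _ _) hr.le))

/-- **time-Type-I ⇒ sub-parabolic Morrey, elementary**: `‖u(t,x)‖ ≤ C/√(T-t)` eventually gives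
`∫_{B(x₀,r)} |u(t)|² ≤ V₁ C² r³/(T-t) ≤ V₁ C² r` for `r² ≤ T-t` (no certificate ladder, no energy bound). -/
theorem subparabolicMorreyNear_of_typeI {u : ℝ → (EuclideanSpace ℝ (Fin 3)) → (EuclideanSpace ℝ (Fin 3))} {T : ℝ}
    (hTI : IsTypeIBlowup u T) : SubparabolicMorreyNear u T := by
  obtain ⟨C, hC⟩ := hTI
  obtain ⟨T₁, hT₁, hsub⟩ := mem_nhdsLT_iff_exists_Ioo_subset.1 hC
  have hV : 0 ≤ V₁ := V₁_nonneg
  refine ⟨V₁ * C ^ 2 + 1, by positivity, T₁, hT₁, fun t ht x₀ r hr hrs => ?_⟩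
  have hrate : ∀ x, ‖u t x‖ ≤ C / Real.sqrt (T - t) := hsub ht
  have hs : 0 < T - t := sub_pos.2 ht.2
  have hpt : ∀ x, ‖u t x‖ₑ ^ 2 ≤ ENNReal.ofReal (C ^ 2 / (T - t)) := by
    intro x
    rw [← ofReal_norm, ← ENNReal.ofReal_pow (norm_nonneg _)]
    refine ENNReal.ofReal_le_ofReal ?_
    have h1 : ‖u t x‖ ^ 2 ≤ (C / Real.sqrt (T - t)) ^ 2 :=
      pow_le_pow_left₀ (norm_nonneg _) (hrate x) 2
    rwa [div_pow, Real.sq_sqrt hs.le] at h1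
  calc ∫⁻ x in ball x₀ r, ‖u t x‖ₑ ^ 2
      ≤ ∫⁻ x in ball x₀ r, ENNReal.ofReal (C ^ 2 / (T - t)) := lintegral_mono fun x => hpt x
    _ = ENNReal.ofReal (C ^ 2 / (T - t)) * volume (ball x₀ r) := setLIntegral_const _ _
    _ = ENNReal.ofReal (C ^ 2 / (T - t) * (r ^ 3 * V₁)) := by
        rw [volume_ball_eq x₀ hr, ← ENNReal.ofReal_mul (by positivity)]
    _ ≤ ENNReal.ofReal ((V₁ * C ^ 2 + 1) * r) := by
        refine ENNReal.ofReal_le_ofReal ?_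
        have h1 : C ^ 2 / (T - t) * (r ^ 3 * V₁) = V₁ * C ^ 2 * r * (r ^ 2 / (T - t)) := by
          field_simp
        have h2 : r ^ 2 / (T - t) ≤ 1 := (div_le_one hs).2 hrs
        rw [h1]
        nlinarith [mul_nonneg (mul_nonneg hV (sq_nonneg C)) hr.le, sq_nonneg C]

/-! ## §2  The pointwise bound `‖u(t)‖₃⁶ ≤ C₁ δ(t) + C₂/(T-t)` on the sub-parabolic class -/

/-- **Slice bound on the sub-parabolic class**: for a classical solution on `[0,T)`, Leray–Hopf from `u 0`,
with `SubparabolicMorreyNear u T`, there are `T₂ ∈ (0,T)`, `C₁ < ∞` and `C₂ ≥ 0` with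
`(∫|u(t)|³)² ≤ C₁ · ∫|∇u(t)|² + C₂/(T-t)` for all `t ∈ (T₂,T)` (support file 9 with `ρ⋆ = √(T-t)/2`,
`M₂ = 2M`; `C₁ = (1152 M/V₁)·E`, `C₂ = 1152 M E²/V₁`, `E = 2·kineticEnergy(u 0)`). -/
theorem l3cube_sq_le_of_subparabolicMorrey {ν T : ℝ} (hν : 0 < ν) (hT : 0 < T)
    {u : ℝ → (EuclideanSpace ℝ (Fin 3)) → (EuclideanSpace ℝ (Fin 3))} {p : ℝ → (EuclideanSpace ℝ (Fin 3)) → ℝ}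
    (hcl : IsClassicalNSSolutionOn (Ico 0 T) ν 0 u p) (hLH : IsLerayHopfOn T ν 0 (u 0) u)
    (hS : SubparabolicMorreyNear u T) :
    ∃ T₂ ∈ Ioo 0 T, ∃ C₁ : ℝ≥0∞, C₁ ≠ ⊤ ∧ ∃ C₂ : ℝ, 0 ≤ C₂ ∧ ∀ t ∈ Ioo T₂ T,
      (∫⁻ y, ‖u t y‖ₑ ^ (3 : ℕ)) ^ 2 ≤ C₁ * dissipRate u t + ENNReal.ofReal (C₂ / (T - t)) := by
  have hV : 0 < V₁ := by
    rw [V₁]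
    exact ENNReal.toReal_pos (measure_ball_pos volume (0 : EuclideanSpace ℝ (Fin 3)) one_pos).ne'
      measure_ball_lt_top.ne
  obtain ⟨M, hM, T₁, hT₁, hMor⟩ := hS
  set e₀ : ℝ := 2 * VectorCalculus.kineticEnergy (u 0) with he₀
  have he₀nn : 0 ≤ e₀ := mul_nonneg zero_le_two (kineticEnergy_nonneg _)
  set T₂ : ℝ := max T₁ (T / 2) with hT₂
  have hT₂mem : T₂ ∈ Ioo 0 T := ⟨lt_max_of_lt_right (by linarith), max_lt hT₁ (by linarith)⟩
  refine ⟨T₂, hT₂mem, ENNReal.ofReal (576 * (2 * M) / V₁) * ENNReal.ofReal e₀,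
    ENNReal.mul_ne_top ENNReal.ofReal_ne_top ENNReal.ofReal_ne_top, 1152 * M * e₀ ^ 2 / V₁, by positivity,
    fun t ht => ?_⟩
  have htT₁ : T₁ < t := lt_of_le_of_lt (le_max_left _ _) ht.1
  have ht0 : 0 < t := hT₂mem.1.trans ht.1
  have htc : t ∈ Ico 0 T := ⟨ht0.le, ht.2⟩
  have hs : 0 < T - t := sub_pos.2 ht.2
  set ρs : ℝ := Real.sqrt (T - t) / 2 with hρs
  have hρs0 : 0 < ρs := by positivity
  have hE : ∫⁻ y, ‖u t y‖ₑ ^ 2 ≤ ENNReal.ofReal e₀ := hLH.lintegral_enorm_sq_le hν.le ⟨ht0.le, ht.2.le⟩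
  have hf : ContDiff ℝ 1 (u t) := (hcl.contDiff_velocity htc).of_le (by exact_mod_cast le_top)
  -- closed-ball Morrey at radii `≤ √(T-t)/2` from the open-ball bound at the doubled radius
  have hMor' : ∀ (x₀ : EuclideanSpace ℝ (Fin 3)) (ρ : ℝ), 0 < ρ → ρ ≤ ρs →
      ∫⁻ y in closedBall x₀ ρ, ‖u t y‖ₑ ^ 2 ≤ ENNReal.ofReal (2 * M * ρ) := by
    intro x₀ ρ hρ hρle
    have h2ρ : (2 * ρ) ^ 2 ≤ T - t := by
      have h1 : 2 * ρ ≤ Real.sqrt (T - t) := by rw [hρs] at hρle; linarith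
      calc (2 * ρ) ^ 2 ≤ Real.sqrt (T - t) ^ 2 := pow_le_pow_left₀ (by positivity) h1 2
        _ = T - t := Real.sq_sqrt hs.le
    calc ∫⁻ y in closedBall x₀ ρ, ‖u t y‖ₑ ^ 2 ≤ ∫⁻ y in ball x₀ (2 * ρ), ‖u t y‖ₑ ^ 2 :=
          lintegral_mono_set (closedBall_subset_ball (by linarith))
      _ ≤ ENNReal.ofReal (M * (2 * ρ)) := hMor t ⟨htT₁, ht.2⟩ x₀ (2 * ρ) (by positivity) h2ρ
      _ = ENNReal.ofReal (2 * M * ρ) := by ring_nf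
  have h1 := lintegral_cube_sq_le_of_morreyBelow hf (by positivity : 0 < 2 * M) hρs0 hMor'
    (ne_top_of_le_ne_top ENNReal.ofReal_ne_top hE)
  have hD : ∫⁻ y, ‖fderiv ℝ (u t) y‖ₑ ^ 2 ≤ dissipRate u t := by
    change ∫⁻ y, ‖fderiv ℝ (u t) y‖ₑ ^ 2 ≤ ∫⁻ y, ENNReal.ofReal (frobeniusNormSq (fderiv ℝ (u t) y))
    refine lintegral_mono fun y => ?_
    rw [← ofReal_norm, ← ENNReal.ofReal_pow (norm_nonneg _)]
    exact ENNReal.ofReal_le_ofReal (sq_opNorm_le_frobeniusNormSq _)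
  have hρs2 : V₁ * ρs ^ 2 = V₁ * (T - t) / 4 := by
    rw [hρs, div_pow, Real.sq_sqrt hs.le]; ring
  calc (∫⁻ y, ‖u t y‖ₑ ^ (3 : ℕ)) ^ 2
      ≤ ENNReal.ofReal (576 * (2 * M) / V₁) * (∫⁻ y, ‖u t y‖ₑ ^ 2) * (∫⁻ y, ‖fderiv ℝ (u t) y‖ₑ ^ 2) +
          ENNReal.ofReal (144 * (2 * M) / (V₁ * ρs ^ 2)) * (∫⁻ y, ‖u t y‖ₑ ^ 2) ^ 2 := h1
    _ ≤ ENNReal.ofReal (576 * (2 * M) / V₁) * ENNReal.ofReal e₀ * dissipRate u t +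
          ENNReal.ofReal (144 * (2 * M) / (V₁ * ρs ^ 2)) * (ENNReal.ofReal e₀) ^ 2 := by
        gcongr
    _ = ENNReal.ofReal (576 * (2 * M) / V₁) * ENNReal.ofReal e₀ * dissipRate u t +
          ENNReal.ofReal (1152 * M * e₀ ^ 2 / V₁ / (T - t)) := by
        congr 1
        rw [← ENNReal.ofReal_pow he₀nn, ← ENNReal.ofReal_mul (by positivity), hρs2]
        congr 1
        field_simp
        ring

/-! ## §3  THEOREM J‴: every `q < 6` on the sub-parabolic class -/

/-- **THEOREM J‴.**  For a classical solution on `[0,T)`, Leray–Hopf from `u 0`, that is sub-parabolic-Morrey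
near `T`: `∫_{T₂}^{T} ‖u(t)‖₃^q dt < ∞` for EVERY `0 ≤ q < 6`.  (The full-Morrey hypothesis of THEOREM J′ is needed
only for the endpoint `q = 6`.) -/
theorem jaw_lt_six_of_subparabolicMorrey {ν T : ℝ} (hν : 0 < ν) (hT : 0 < T)
    {u : ℝ → (EuclideanSpace ℝ (Fin 3)) → (EuclideanSpace ℝ (Fin 3))} {p : ℝ → (EuclideanSpace ℝ (Fin 3)) → ℝ}
    (hcl : IsClassicalNSSolutionOn (Ico 0 T) ν 0 u p) (hLH : IsLerayHopfOn T ν 0 (u 0) u)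
    (hS : SubparabolicMorreyNear u T) {q : ℝ} (hq0 : 0 ≤ q) (hq6 : q < 6) :
    ∃ T₂ ∈ Ioo 0 T, (∫⁻ t in Ioo T₂ T, eLpNorm (u t) 3 volume ^ q) < ⊤ := by
  obtain ⟨T₂, hT₂, C₁, hC₁, C₂, hC₂, hpt⟩ := l3cube_sq_le_of_subparabolicMorrey hν hT hcl hLH hS
  set a : ℝ := q / 6 with ha
  have ha0 : 0 ≤ a := by positivity
  have ha1 : a ≤ 1 := by rw [ha]; linarith
  have ha1' : a < 1 := by rw [ha]; linarith
  -- pointwise: `‖u‖₃^q = ((∫|u|³)²)^a ≤ C₁^a (δ + 1) + ofReal (C₂^a (T-t)^{-a})`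
  have hbound : ∀ t ∈ Ioo T₂ T, eLpNorm (u t) 3 volume ^ q ≤
      C₁ ^ a * (dissipRate u t + 1) + ENNReal.ofReal (C₂ ^ a * (T - t) ^ (-a)) := by
    intro t ht
    have hs : 0 < T - t := sub_pos.2 ht.2
    have h1 : eLpNorm (u t) 3 volume ^ q = ((∫⁻ y, ‖u t y‖ₑ ^ (3 : ℕ)) ^ 2) ^ a := by
      rw [eLpNorm_three_rpow_eq, ← ENNReal.rpow_two, ← ENNReal.rpow_mul]
      congr 1
      rw [ha]; ring
    rw [h1]
    calc ((∫⁻ y, ‖u t y‖ₑ ^ (3 : ℕ)) ^ 2) ^ a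
        ≤ (C₁ * dissipRate u t + ENNReal.ofReal (C₂ / (T - t))) ^ a := ENNReal.rpow_le_rpow (hpt t ht) ha0
      _ ≤ (C₁ * dissipRate u t) ^ a + (ENNReal.ofReal (C₂ / (T - t))) ^ a :=
          ENNReal.rpow_add_le_add_rpow _ _ ha0 ha1
      _ ≤ C₁ ^ a * (dissipRate u t + 1) + ENNReal.ofReal (C₂ ^ a * (T - t) ^ (-a)) := by
          gcongr
          · rw [ENNReal.mul_rpow_of_nonneg _ _ ha0]
            gcongr
            rcases le_total (dissipRate u t) 1 with hx | hx
            · exact (ENNReal.rpow_le_one hx ha0).trans le_add_self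
            · exact ((ENNReal.rpow_le_rpow_of_exponent_le hx ha1).trans_eq (ENNReal.rpow_one _)).trans
                le_self_add
          · refine le_of_eq ?_
            rw [ENNReal.ofReal_rpow_of_nonneg (by positivity) ha0, div_eq_mul_inv,
              Real.mul_rpow hC₂ (inv_nonneg.2 hs.le), Real.inv_rpow hs.le, Real.rpow_neg hs.le]
  refine ⟨T₂, hT₂, ?_⟩
  have hC₁a : C₁ ^ a ≠ ⊤ := ENNReal.rpow_ne_top_of_nonneg ha0 hC₁
  have hmeas2 : Measurable fun t : ℝ => ENNReal.ofReal (C₂ ^ a * (T - t) ^ (-a)) :=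
    (measurable_const.mul ((measurable_const.sub measurable_id).pow_const _)).ennreal_ofReal
  have hdiss : ∫⁻ t in Ioo T₂ T, dissipRate u t < ⊤ :=
    lt_of_le_of_lt (lintegral_mono_set (Ioo_subset_Ioo_left hT₂.1.le)) (dissip_lt_top hcl hLH)
  calc ∫⁻ t in Ioo T₂ T, eLpNorm (u t) 3 volume ^ q
      ≤ ∫⁻ t in Ioo T₂ T, (C₁ ^ a * (dissipRate u t + 1) + ENNReal.ofReal (C₂ ^ a * (T - t) ^ (-a))) :=
        setLIntegral_mono' measurableSet_Ioo hbound
    _ = (∫⁻ t in Ioo T₂ T, C₁ ^ a * (dissipRate u t + 1)) +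
          ∫⁻ t in Ioo T₂ T, ENNReal.ofReal (C₂ ^ a * (T - t) ^ (-a)) := lintegral_add_right _ hmeas2
    _ < ⊤ := by
        refine ENNReal.add_lt_top.2 ⟨?_, lintegral_Ioo_rpow_neg_lt_top hT₂.2 ha1'⟩
        rw [lintegral_const_mul' _ _ hC₁a]
        refine ENNReal.mul_lt_top hC₁a.lt_top ?_
        calc ∫⁻ t in Ioo T₂ T, (dissipRate u t + 1)
            = (∫⁻ t in Ioo T₂ T, dissipRate u t) + ∫⁻ t in Ioo T₂ T, (1 : ℝ≥0∞) :=
              lintegral_add_right _ measurable_const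
          _ < ⊤ := by
              refine ENNReal.add_lt_top.2 ⟨hdiss, ?_⟩
              rw [setLIntegral_const, Real.volume_Ioo]
              exact ENNReal.mul_lt_top ENNReal.one_lt_top ENNReal.ofReal_lt_top

/-- **The parent crux's clause on the sub-parabolic class**: every classical solution on `[0,T)`, Leray–Hopf
from a rapidly decaying datum, that is sub-parabolic-Morrey near `T` satisfies the `L3CascadeJaw` clause for every
`q ∈ (4,5)` (the decay hypothesis is carried for the frame's shape only). -/
theorem l3CascadeJaw_clause_of_subparabolicMorrey (q : ℝ) (hq4 : 4 < q) (hq5 : q < 5) {ν T : ℝ}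
    (hν : 0 < ν) (hT : 0 < T)
    {u : ℝ → (EuclideanSpace ℝ (Fin 3)) → (EuclideanSpace ℝ (Fin 3))} {p : ℝ → (EuclideanSpace ℝ (Fin 3)) → ℝ}
    (hcl : IsClassicalNSSolutionOn (Ico 0 T) ν 0 u p) (hLH : IsLerayHopfOn T ν 0 (u 0) u)
    (_hdec : HasRapidSpatialDecay (u 0)) (hS : SubparabolicMorreyNear u T) :
    ∃ T₂ ∈ Ioo 0 T, (∫⁻ t in Ioo T₂ T, eLpNorm (u t) 3 volume ^ q) < ⊤ :=
  jaw_lt_six_of_subparabolicMorrey hν hT hcl hLH hS (by linarith) (by linarith)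

/-! ## §4  Most times `K₃(1)` on sub-parabolic-Morrey blow-ups -/

/-- **The `L³`-fast set is log-null on the sub-parabolic class, above a threshold**: there are `T₂ ∈ (0,T)` and
`A₀ ≥ 0` such that for every `A > A₀` the set `{t : ‖u(t)‖₃³ > A/√(T-t)}` satisfies
`∫_{(T₂,T)} 1_{fast} dt/(T-t) < ∞` (at a fast time `(A² - A₀²)/(T-t) < C₁ δ(t)`, and `∫δ < ∞`). -/
theorem lintegral_fast_inv_sub_lt_top_of_subparabolicMorrey {ν T : ℝ} (hν : 0 < ν) (hT : 0 < T)
    {u : ℝ → (EuclideanSpace ℝ (Fin 3)) → (EuclideanSpace ℝ (Fin 3))} {p : ℝ → (EuclideanSpace ℝ (Fin 3)) → ℝ}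
    (hcl : IsClassicalNSSolutionOn (Ico 0 T) ν 0 u p) (hLH : IsLerayHopfOn T ν 0 (u 0) u)
    (hS : SubparabolicMorreyNear u T) :
    ∃ T₂ ∈ Ioo 0 T, ∃ A₀ : ℝ, 0 ≤ A₀ ∧ ∀ A : ℝ, A₀ < A →
      ∫⁻ t in Ioo T₂ T, {t | ENNReal.ofReal (A / Real.sqrt (T - t)) < eLpNorm (u t) 3 volume ^ (3 : ℝ)}.indicator
          (fun t => ENNReal.ofReal ((T - t)⁻¹)) t < ⊤ := by
  obtain ⟨T₂, hT₂, C₁, hC₁, C₂, hC₂, hpt⟩ := l3cube_sq_le_of_subparabolicMorrey hν hT hcl hLH hS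
  refine ⟨T₂, hT₂, Real.sqrt C₂, Real.sqrt_nonneg _, fun A hA => ?_⟩
  have hA0 : 0 < A := lt_of_le_of_lt (Real.sqrt_nonneg _) hA
  have hAC : C₂ < A ^ 2 := by
    calc C₂ = Real.sqrt C₂ ^ 2 := (Real.sq_sqrt hC₂).symm
      _ < A ^ 2 := pow_lt_pow_left₀ hA (Real.sqrt_nonneg _) two_ne_zero
  set κ : ℝ := A ^ 2 - C₂ with hκ
  have hκpos : 0 < κ := by rw [hκ]; linarith
  set F : Set ℝ := {t | ENNReal.ofReal (A / Real.sqrt (T - t)) < eLpNorm (u t) 3 volume ^ (3 : ℝ)} with hF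
  -- pointwise on `(T₂,T)`: `1_F(t) κ/(T-t) ≤ C₁ δ(t)`
  have hptF : ∀ t ∈ Ioo T₂ T, F.indicator (fun t => ENNReal.ofReal (κ / (T - t))) t ≤ C₁ * dissipRate u t := by
    intro t ht
    have hs : 0 < T - t := sub_pos.2 ht.2
    by_cases htF : t ∈ F
    · rw [indicator_of_mem htF]
      have h1 : ENNReal.ofReal (A ^ 2 / (T - t)) < eLpNorm (u t) 3 volume ^ (6 : ℝ) :=
        ofReal_sq_div_lt_rpow_six hA0.le hs htF
      rw [eLpNorm_three_rpow_six_eq] at h1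
      have h2 : ENNReal.ofReal (κ / (T - t)) + ENNReal.ofReal (C₂ / (T - t)) <
          C₁ * dissipRate u t + ENNReal.ofReal (C₂ / (T - t)) := by
        rw [← ENNReal.ofReal_add (by positivity) (by positivity)]
        have h3 : κ / (T - t) + C₂ / (T - t) = A ^ 2 / (T - t) := by rw [hκ]; field_simp; ring
        rw [h3]
        exact lt_of_lt_of_le h1 (hpt t ht)
      exact ((ENNReal.add_lt_add_iff_right ENNReal.ofReal_ne_top).1 h2).le
    · rw [indicator_of_notMem htF]
      exact bot_le
  have hdiss : ∫⁻ t in Ioo T₂ T, dissipRate u t < ⊤ :=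
    lt_of_le_of_lt (lintegral_mono_set (Ioo_subset_Ioo_left hT₂.1.le)) (dissip_lt_top hcl hLH)
  have hfin : ∫⁻ t in Ioo T₂ T, F.indicator (fun t => ENNReal.ofReal (κ / (T - t))) t < ⊤ :=
    calc ∫⁻ t in Ioo T₂ T, F.indicator (fun t => ENNReal.ofReal (κ / (T - t))) t
        ≤ ∫⁻ t in Ioo T₂ T, C₁ * dissipRate u t := setLIntegral_mono' measurableSet_Ioo hptF
      _ = C₁ * ∫⁻ t in Ioo T₂ T, dissipRate u t := lintegral_const_mul' _ _ hC₁
      _ < ⊤ := ENNReal.mul_lt_top hC₁.lt_top hdiss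
  -- divide by `κ`
  have heq : ∀ t, F.indicator (fun t => ENNReal.ofReal ((T - t)⁻¹)) t =
      ENNReal.ofReal κ⁻¹ * F.indicator (fun t => ENNReal.ofReal (κ / (T - t))) t := by
    intro t
    by_cases htF : t ∈ F
    · rw [indicator_of_mem htF, indicator_of_mem htF, ← ENNReal.ofReal_mul (inv_nonneg.2 hκpos.le)]
      congr 1
      rw [div_eq_mul_inv, ← mul_assoc, inv_mul_cancel₀ hκpos.ne', one_mul]
    · rw [indicator_of_notMem htF, indicator_of_notMem htF, mul_zero]
  calc ∫⁻ t in Ioo T₂ T, F.indicator (fun t => ENNReal.ofReal ((T - t)⁻¹)) t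
      = ∫⁻ t in Ioo T₂ T, ENNReal.ofReal κ⁻¹ * F.indicator (fun t => ENNReal.ofReal (κ / (T - t))) t :=
        lintegral_congr fun t => heq t
    _ = ENNReal.ofReal κ⁻¹ * ∫⁻ t in Ioo T₂ T, F.indicator (fun t => ENNReal.ofReal (κ / (T - t))) t :=
        lintegral_const_mul' _ _ ENNReal.ofReal_ne_top
    _ < ⊤ := ENNReal.mul_lt_top ENNReal.ofReal_lt_top hfin

/-- **`K₃(1)` at MOST late times on sub-parabolic-Morrey blow-ups.**  A frame blow-up (classical on `[0,T)`,
Leray–Hopf from a rapidly decaying datum, no smooth extension past `T`) that is sub-parabolic-Morrey near `T`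
admits a threshold `A₀ ≥ 0` such that for every `A > A₀` there are `m, R₀ > 0` and `T₁ ∈ (0,T)` with:
the fast set `F_A = {t : ‖u(t)‖₃³ > A/√(T-t)}` log-null on `(T₁,T)` and of density `0` at `T`, and the crux clause
`FatClauseAt m R₀ 1 u T t` at every `t ∈ (T₁,T) ∖ F_A`. -/
theorem effSat_mostTimes_of_subparabolicMorrey {ν T : ℝ} (hν : 0 < ν) (hT : 0 < T)
    {u : ℝ → (EuclideanSpace ℝ (Fin 3)) → (EuclideanSpace ℝ (Fin 3))} {p : ℝ → (EuclideanSpace ℝ (Fin 3)) → ℝ}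
    (hcl : IsClassicalNSSolutionOn (Ico 0 T) ν 0 u p) (hLH : IsLerayHopfOn T ν 0 (u 0) u)
    (hdec : HasRapidSpatialDecay (u 0)) (hnext : ¬ HasSmoothExtensionPast ν 0 u T)
    (hS : SubparabolicMorreyNear u T) :
    ∃ A₀ : ℝ, 0 ≤ A₀ ∧ ∀ A : ℝ, A₀ < A → ∃ m : ℝ, 0 < m ∧ ∃ R₀ : ℝ, 0 < R₀ ∧ ∃ T₁ ∈ Ioo 0 T,
      (∫⁻ t in Ioo T₁ T, {t | ENNReal.ofReal (A / Real.sqrt (T - t)) < eLpNorm (u t) 3 volume ^ (3 : ℝ)}.indicator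
          (fun t => ENNReal.ofReal ((T - t)⁻¹)) t < ⊤) ∧
      (∀ ε : ℝ, 0 < ε → ∃ h₀ : ℝ, 0 < h₀ ∧ ∀ h : ℝ, 0 < h → h < h₀ →
        volume ({t | ENNReal.ofReal (A / Real.sqrt (T - t)) < eLpNorm (u t) 3 volume ^ (3 : ℝ)} ∩ Ioo (T - h) T)
          ≤ ENNReal.ofReal (ε * h)) ∧
      ∀ t ∈ Ioo T₁ T,
        t ∉ {t | ENNReal.ofReal (A / Real.sqrt (T - t)) < eLpNorm (u t) 3 volume ^ (3 : ℝ)} →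
          FatClauseAt m R₀ 1 u T t := by
  obtain ⟨T₂, hT₂, A₀, hA₀, hlog⟩ := lintegral_fast_inv_sub_lt_top_of_subparabolicMorrey hν hT hcl hLH hS
  refine ⟨A₀, hA₀, fun A hA => ?_⟩
  have hApos : 0 < A := lt_of_le_of_lt hA₀ hA
  have hint := hlog A hA
  obtain ⟨m, hm, R₀, hR₀, T₁, hT₁, hcl'⟩ := fatClauseAt_offFast_of_blowup hν hT hcl hLH hdec hnext hApos
  have hdens := density_zero_of_lintegral_indicator_inv_sub_lt_top hT₂.2
    (nullMeasurableSet_fast_of_frame hcl hT₂.1.le A) hint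
  set T₃ : ℝ := max T₁ T₂ with hT₃
  have hT₃mem : T₃ ∈ Ioo 0 T := ⟨lt_max_of_lt_right hT₂.1, max_lt hT₁ hT₂.2⟩
  refine ⟨m, hm, R₀, hR₀, T₃, hT₃mem, ?_, hdens, fun t ht hnf => ?_⟩
  · exact lt_of_le_of_lt (lintegral_mono_set (Ioo_subset_Ioo_left (le_max_right _ _))) hint
  · have ht1 : t ∈ Ioo T₁ T := ⟨lt_of_le_of_lt (le_max_left _ _) ht.1, ht.2⟩
    exact hcl' t ht1 (not_lt.1 hnf)

end Summit.NavierStokesRegularity.NavierStokesRegularity.Theorems.L3TimeExponentPincerSubparabolicMorreyJaw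

end
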